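import Literature.Analysis.InverseSpectral.KreinStringWeylLimit
import HarnessLib

/-!
# Kreĭn strings on the negative axis: bounds for `q_S(-s)` and degenerate limits

For `s > 0` the principal Titchmarsh–Weyl function `q_S(-s) = ∫₀ᴸ dx/φ(x,-s)²` is a positive
number controlled by the mass near the left end. This file turns the finite-`x` bounds of
`KreinStringWeylNeg` into bounds for `q_S(-s)` itself:

* `psi_div_phi_neg_re_le_weyl` : `ψ(x,-s)/φ(x,-s) ≤ q_S(-s)`;
* `weyl_neg_re_le_length`      : `q_S(-s) ≤ L`;
* `weyl_neg_re_le_of_mass`     : `q_S(-s) ≤ a + (s m(a))⁻¹` if `m(a) > 0`;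
* `phi_neg_re_le_exp`          : `φ(t,-s) ≤ exp(s x m(x))` on `[0, x]`,

and derives the two **degenerate limits** of sequences of strings used in the approximation proof
of Kreĭn's existence theorem (Kac–Kreĭn 1974 §11; Kotani–Watanabe 1982 §2): if the masses
explode near `0` then `q_{S_n}(-s) → 0` (`tendsto_weyl_neg_zero_of_explode`), and if they vanish
on every bounded interval of ever longer strings then `q_{S_n}(-s) → ∞`
(`tendsto_weyl_neg_atTop_of_vanish`).

## References

KacKrein1974 (§§2, 11), KotaniWatanabe1982 (§2), Tomisaki1988 (§4).
-/

open MeasureTheory Filter Set Topology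
open scoped ENNReal

noncomputable section

namespace Literature.Analysis.InverseSpectral

namespace KreinString

variable (S : KreinString)

/-- Along the end filter, eventually `x ∈ [0, L)` and `x ≥ x₁`. [folklore] -/
lemma eventually_mem_dom_ge {x₁ : ℝ} (hx₁ : x₁ ∈ S.dom) : ∀ᶠ x in S.toEnd, x ∈ S.dom ∧ x₁ ≤ x :=
  S.Ici_inter_dom_mem_toEnd hx₁

/-- **`ψ(x,-s)/φ(x,-s) ≤ q_S(-s)`**: the Weyl quotient increases to its limit.
[cite: KacKrein1974, §2] -/
theorem psi_div_phi_neg_re_le_weyl (hS : ¬ S.IsTrivial) {s : ℝ} (hs : 0 < s) {x : ℝ}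
    (hx : x ∈ S.dom) :
    (S.psi (-(s : ℂ)) x / S.phi (-(s : ℂ)) x).re ≤ (S.principalWeylFunction (-(s : ℂ))).re := by
  haveI := S.toEnd_neBot
  obtain ⟨ht, -, -⟩ := S.tendsto_principalWeylFunction_of_neg hS (z := -(s : ℂ)) (by simp)
    (by simpa using hs)
  refine ge_of_tendsto ((Complex.continuous_re.tendsto _).comp ht) ?_
  filter_upwards [S.eventually_mem_dom_ge hx] with y hy
  exact S.psi_div_phi_neg_re_mono hs.le hy.1 hy.2

/-- **`q_S(-s) ≤ L`.** [cite: KacKrein1974, §2] -/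
theorem weyl_neg_re_le_length (hS : ¬ S.IsTrivial) {s : ℝ} (hs : 0 < s) (hL : S.length ≠ ⊤) :
    (S.principalWeylFunction (-(s : ℂ))).re ≤ S.length.toReal := by
  haveI := S.toEnd_neBot
  obtain ⟨ht, -, -⟩ := S.tendsto_principalWeylFunction_of_neg hS (z := -(s : ℂ)) (by simp)
    (by simpa using hs)
  refine le_of_tendsto ((Complex.continuous_re.tendsto _).comp ht) ?_
  filter_upwards [S.eventually_mem_dom_ge S.zero_mem_dom] with y hy
  refine (S.psi_div_phi_neg_re_le hs.le hy.1).trans ?_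
  exact (ENNReal.ofReal_le_iff_le_toReal hL).1 hy.1.2.le |>.trans' le_rfl

/-- **`q_S(-s) ≤ a + (s m(a))⁻¹`** when the string carries mass on `[0, a]`.
[cite: Tomisaki1988, §4] -/
theorem weyl_neg_re_le_of_mass (hS : ¬ S.IsTrivial) {s : ℝ} (hs : 0 < s) {a : ℝ} (ha : a ∈ S.dom)
    (hma : 0 < S.mass a) :
    (S.principalWeylFunction (-(s : ℂ))).re ≤ a + (s * S.mass a)⁻¹ := by
  haveI := S.toEnd_neBot
  obtain ⟨ht, -, -⟩ := S.tendsto_principalWeylFunction_of_neg hS (z := -(s : ℂ)) (by simp)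
    (by simpa using hs)
  refine le_of_tendsto ((Complex.continuous_re.tendsto _).comp ht) ?_
  filter_upwards [S.eventually_mem_dom_ge ha] with y hy
  exact S.psi_div_phi_neg_re_le_of_mass hs ha.1 hma hy.1 hy.2

/-- **`φ(t,-s) ≤ exp(s · m(x) · x)` for `0 ≤ t ≤ x < L`** (termwise comparison of the Picard series
with the exponential series). [folklore] -/
theorem phi_neg_re_le_exp {s : ℝ} (hs : 0 ≤ s) {x : ℝ} (hx : x ∈ S.dom) {t : ℝ} (ht : t ∈ Icc 0 x) :
    (S.phi (-(s : ℂ)) t).re ≤ Real.exp (s * (S.mass x * x)) := by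
  rw [S.phi_neg_re, Real.exp_eq_exp_ℝ, NormedSpace.exp_eq_tsum_div]
  have htd : t ∈ S.dom := S.Icc_subset_dom hx ht
  have hsum := S.summable_picard_neg continuous_const s htd (f := fun _ => (1 : ℝ))
  have hM : (S.massMeasure (Icc 0 x)).toReal = S.mass x := (S.mass_eq_toReal_Icc x).symm
  refine Summable.tsum_le_tsum (fun n => ?_) hsum (Real.summable_pow_div_factorial _)
  have h1 := S.abs_picard_le hx (f := fun _ => (1 : ℝ)) (C := 1) (fun _ _ => by simp) n ht
  rw [hM, one_mul] at h1
  calc s ^ n * S.picard (fun _ => (1 : ℝ)) n t ≤ s ^ n * ((S.mass x * t) ^ n / n.factorial) :=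
        mul_le_mul_of_nonneg_left ((le_abs_self _).trans h1) (pow_nonneg hs n)
    _ ≤ s ^ n * ((S.mass x * x) ^ n / n.factorial) := by
        gcongr
        · exact mul_nonneg (S.mass_nonneg x) ht.1
        · exact S.mass_nonneg x
        · exact ht.2
    _ = (s * (S.mass x * x)) ^ n / n.factorial := by rw [mul_pow]; ring

end KreinString

/-! ### Degenerate limits of sequences of strings -/

/-- **Exploding masses near `0` force `q(-s) → 0`**: if for every `x > 0` and every `K`,
eventually either the `n`-th string ends before `x` or its mass on `[0, x]` exceeds `K`, then
`q_{S_n}(-s) → 0`. [cite: KotaniWatanabe1982, §2] -/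
theorem tendsto_weyl_neg_zero_of_explode (T : ℕ → KreinString) (hT : ∀ n, ¬ (T n).IsTrivial)
    {s : ℝ} (hs : 0 < s)
    (h : ∀ x : ℝ, 0 < x → ∀ K : ℝ, ∀ᶠ n in atTop, x ∉ (T n).dom ∨ K ≤ (T n).mass x) :
    Tendsto (fun n => ((T n).principalWeylFunction (-(s : ℂ))).re) atTop (𝓝 0) := by
  rw [Metric.tendsto_atTop]
  intro ε hε
  have hx : (0 : ℝ) < ε / 2 := by positivity
  set K : ℝ := 2 / (s * ε) + 1 with hK
  have hK0 : 0 < K := by positivity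
  obtain ⟨N, hN⟩ := eventually_atTop.1 (h (ε / 2) hx K)
  refine ⟨N, fun n hn => ?_⟩
  obtain ⟨-, hpos, -⟩ := (T n).tendsto_principalWeylFunction_of_neg (hT n) (z := -(s : ℂ))
    (by simp) (by simpa using hs)
  rw [Real.dist_eq, sub_zero, abs_of_pos hpos]
  rcases hN n hn with hnd | hKm
  · -- the string ends before `ε/2`
    have hL : (T n).length ≠ ⊤ := by
      intro htop
      exact hnd ⟨hx.le, by simp [htop]⟩
    have h1 := (T n).weyl_neg_re_le_length (hT n) hs hL
    have h2 : (T n).length.toReal ≤ ε / 2 := by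
      have : (T n).length ≤ ENNReal.ofReal (ε / 2) := by
        by_contra hlt
        exact hnd ⟨hx.le, not_le.1 hlt⟩
      have := ENNReal.toReal_mono ENNReal.ofReal_ne_top this
      rwa [ENNReal.toReal_ofReal hx.le] at this
    linarith
  · -- large mass on `[0, ε/2]`
    by_cases hd : ε / 2 ∈ (T n).dom
    · have hm : 0 < (T n).mass (ε / 2) := hK0.trans_le hKm
      have h1 := (T n).weyl_neg_re_le_of_mass (hT n) hs hd hm
      have h2 : (s * (T n).mass (ε / 2))⁻¹ ≤ (s * K)⁻¹ := by
        apply inv_anti₀ (by positivity)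
        exact mul_le_mul_of_nonneg_left hKm hs.le
      have h3 : (s * K)⁻¹ < ε / 2 := by
        rw [inv_lt_comm₀ (by positivity) hx, hK]
        have e1 : (ε / 2)⁻¹ = 2 / ε := by rw [inv_div]
        have e2 : s * (2 / (s * ε) + 1) = 2 / ε + s := by field_simp
        rw [e1, e2]
        linarith
      linarith
    · have hL : (T n).length ≠ ⊤ := by
        intro htop
        exact hd ⟨hx.le, by simp [htop]⟩
      have h1 := (T n).weyl_neg_re_le_length (hT n) hs hL
      have h2 : (T n).length.toReal ≤ ε / 2 := by
        have : (T n).length ≤ ENNReal.ofReal (ε / 2) := by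
          by_contra hlt
          exact hd ⟨hx.le, not_le.1 hlt⟩
        have := ENNReal.toReal_mono ENNReal.ofReal_ne_top this
        rwa [ENNReal.toReal_ofReal hx.le] at this
      linarith

/-- **Vanishing masses on long strings force `q(-s) → ∞`**: if every `x ≥ 0` eventually lies in
the `n`-th string with `m_n(x) → 0`, then `q_{S_n}(-s) → +∞`. [cite: KotaniWatanabe1982, §2] -/
theorem tendsto_weyl_neg_atTop_of_vanish (T : ℕ → KreinString) (hT : ∀ n, ¬ (T n).IsTrivial)
    {s : ℝ} (hs : 0 < s)
    (h : ∀ x : ℝ, 0 ≤ x → (∀ᶠ n in atTop, x ∈ (T n).dom) ∧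
      Tendsto (fun n => (T n).mass x) atTop (𝓝 0)) :
    Tendsto (fun n => ((T n).principalWeylFunction (-(s : ℂ))).re) atTop atTop := by
  rw [tendsto_atTop]
  intro M
  set x : ℝ := 2 * (|M| + 1) with hxdef
  have hx0 : 0 < x := by positivity
  obtain ⟨hdom, hmass⟩ := h x hx0.le
  -- eventually `s · m_n(x) · x ≤ log 2 / 2`, so `φ_n ≤ exp(log 2/2) ≤ 2^{1/2}` and `φ_n² ≤ 2`
  have hsmall : ∀ᶠ n in atTop, s * ((T n).mass x * x) ≤ Real.log 2 / 2 := by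
    have hc : Tendsto (fun n => s * ((T n).mass x * x)) atTop (𝓝 (s * (0 * x))) :=
      (hmass.mul_const x).const_mul s
    rw [zero_mul, mul_zero] at hc
    exact hc.eventually (Iic_mem_nhds (by positivity))
  filter_upwards [hdom, hsmall] with n hn hsm
  have hphi : ∀ t ∈ Icc 0 x, ((T n).phi (-(s : ℂ)) t).re ^ 2 ≤ 2 := by
    intro t ht
    have h1 := (T n).phi_neg_re_le_exp hs.le hn ht
    have h0 : 0 ≤ ((T n).phi (-(s : ℂ)) t).re :=
      zero_le_one.trans ((T n).one_le_phi_neg_re hs.le ((T n).Icc_subset_dom hn ht))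
    calc ((T n).phi (-(s : ℂ)) t).re ^ 2 ≤ (Real.exp (s * ((T n).mass x * x))) ^ 2 := by
          gcongr
      _ ≤ (Real.exp (Real.log 2 / 2)) ^ 2 := by gcongr
      _ = 2 := by
          rw [← Real.exp_nat_mul]
          norm_num
          rw [show (2 : ℝ) * (Real.log 2 / 2) = Real.log 2 by ring, Real.exp_log two_pos]
  -- `q_n ≥ ∫₀ˣ φ_n⁻² ≥ x/2 ≥ M`
  have hq := (T n).psi_div_phi_neg_re_le_weyl (hT n) hs hn
  rw [(T n).psi_div_phi_neg_re hs.le hn] at hq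
  have hint : x / 2 ≤ ∫ t in (0 : ℝ)..x, (((T n).phi (-(s : ℂ)) t).re ^ 2)⁻¹ := by
    have h1 : ∫ _ in (0 : ℝ)..x, (1 / 2 : ℝ) ≤
        ∫ t in (0 : ℝ)..x, (((T n).phi (-(s : ℂ)) t).re ^ 2)⁻¹ :=
      intervalIntegral.integral_mono_on hx0.le intervalIntegrable_const
        (((T n).continuousOn_inv_phi_neg_re_sq s hs.le hn).intervalIntegrable_of_Icc hx0.le)
        (fun t ht => by
          rw [one_div, inv_le_inv₀ two_pos]
          · exact hphi t ht
          · exact pow_pos (zero_lt_one.trans_le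
              ((T n).one_le_phi_neg_re hs.le ((T n).Icc_subset_dom hn ht))) 2)
    simp at h1
    linarith
  have : M ≤ x / 2 := by rw [hxdef]; linarith [le_abs_self M]
  linarith

end Literature.Analysis.InverseSpectral

end
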